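import Summits.HodgeConjecture.HodgeConjecture.Theorems.SplitImpliesAllExactReach
import Summits.HodgeConjecture.HodgeConjecture.Theorems.Ring2HypothesesWeilComponentsGerm
import Summits.HodgeConjecture.HodgeConjecture.Theorems.Ring2AbelianAllNonsplitTypeIIWeilClassesAnticompatible
import HarnessLib

/-!
# Route `SplitImpliesAll` — the TYPE-II ANCHOR: K1 (`NonsplitSixfoldCells`) priced, per cell and for all sixfolds, as
  «type-II pointedness» + ONE local germ statement at type-II members (vhodge seat P3, gen 17)

SUPPORT file for item stmt-HodgeConjecture-19149 (`SplitImpliesAll.NonsplitSixfoldCells`, K1). The tribunal's key risk for the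
route (judge dbd1c8a1bd15233d): «VHC on a non-split cell may be no easier than HC on it; what moves it up: one representative at
one anchor». Ring 2 types the cell mechanism «one anchor member + the local germ of the algebraicity locus ⟹ the whole
component» over an ABSTRACT anchor predicate (`Ring2.Hypotheses.PointedWeilFamiliesComponent n d δ anchor`,
`Ring2.Hypotheses.LocalWeilVHCAtComponent n d δ anchor`, engines `weilClassesComponent_of_pointed_of_local` /
`…_of_variational`) and instantiates it at CM anchors (valid only under `HC_CM` or on divisor-generated CM fibres — ISOLATED
points of a non-split cell) and at the tautological algebraic anchor. This file adds the one anchor that is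
(a) VALID FACT-FREE and (b) met on a POSITIVE-DIMENSIONAL algebraic sub-locus of the NON-SPLIT hyperbolic cells:

* §1 `antiCompatibleAnchor n d X x` — the marked fibre `X`, with its class `x`, is charted by `(A₀, φ₀)`, `φ₀² = -d`, with `x`
  in the Weil plane of `(A₀, φ₀)`, and `A₀` carries an ALGEBRAIC degree-two class `y` with `φ₀^*y = -d·y` (anti-compatible)
  and `y^{2n} ≠ 0`. VALID WITHOUT ANY FACT (`antiCompatibleAnchor_valid`): ring 2's rational form of the `V₊`-projection
  criterion `Ring2AbelianAll.NonsplitTypeIIWeilClassesAnticompatible.weilClassesOf_le_algebraicClasses_of_anticompatible`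
  (Moonen–Zarhin's second criterion on the tree's carriers). Where it is met: exactly at the members carrying a
  Rosati-symmetric invertible `ψ` anticommuting with `φ` — Albert TYPE II, `D = K ⊕ Kψ` an indefinite quaternion algebra;
  e.g. the 6-dimensional PEL family `𝔔(D₆)`, `D₆ = (-3,2)_ℚ`, inside the 9-dimensional `(ℚ(√-3), (3,3), δ = [-2])` cell
  (ring 2 account TYPEII-ANCHOR-G22 §1–3; the tribunal's T3 witness locus `nonsplitSixfolds_of_plusPart_pow_ne_zero`).
  It refines the algebraic anchor (`algebraicAnchor_of_antiCompatibleAnchor`), so pointedness at it is STRONGER than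
  R∞anc(δ) and the germ at it is WEAKER than the germ at all algebraic fibres (§2).
* §2 the engine at this anchor, every `n, d ≥ 1`, every `δ`, NO `HC_CM`, NO J1, NO Markman:
  `PointedWeilFamiliesComponent n d δ (antiCompatibleAnchor n d) → LocalWeilVHCAtComponent n d δ (antiCompatibleAnchor n d) →
  WeilClassesComponent n d δ` and `→ WeilVariationalHodgeComponent n d δ`; conversely the germ at this anchor is a CONSEQUENCE
  of the cell (`localWeilVHCAtTypeII_of_weilClassesComponent`), so GRANTED TYPE-II POINTEDNESS the cell's Hodge statement,
  its variational instance (the K1 cell) and the local germ at type-II members are all EQUIVALENT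
  (`weilClassesComponent_iff_localAtTypeII_of_typeIIPointed`, `weilVariationalHodgeComponent_iff_localAtTypeII_of_typeIIPointed`).
* §3 sixfolds: K1 ⟸ (type-II pointedness ∧ type-II germ on every non-split right-sign cell), fact-free
  (`nonsplitSixfoldCells_of_typeIIPointed_of_local`); granted type-II pointedness, **K1 ↔ the type-II germ statement**
  (`nonsplitSixfoldCells_iff_localAtTypeII_of_typeIIPointed`); the leaf `WeilSixfolds` ⟸ Markman's split theorem (hypothesis,
  preprint) ∧ pointedness ∧ germ, and granted Markman + pointedness **`WeilSixfolds` ↔ the type-II germ statement**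
  (`weilSixfolds_iff_localAtTypeII_of_markman2025_of_typeIIPointed`) — the seat brief's «single extra germ statement that
  extends it to all Weil type of dimension 6», now with a fact-free anchor instead of `HC_CM`; and the route's plan-only BC5
  rung (`Lines/birth.lean: stub_rung_firstCell : WeilVariationalHodgeComponent 3 3 [-2]`) in germ currency
  (`rung_firstCell_of_typeIIPointed_of_local`): pointedness of the `(ℚ(√-3), 6, [-2])` cell at `𝔔(D₆)` + the germ at
  `𝔔(D₆)` members.

HONEST LABEL. Typed reductions only; 0 rungs; nothing here proves a case of the Hodge conjecture, `W₆`, `HC_AV` or HC, and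
`HC_CM` occurs nowhere. The two inputs are HYPOTHESES, not facts and not route items: (P) TYPE-II POINTEDNESS of a cell
`(ℚ(√-d), 2n, δ)` — every polarized member lies, with its Weil class, in a smooth projective δ-Weil family meeting a
type-II member — is a MODULI/ARITHMETIC statement (does the `K`-hermitian space of signature `(n,n)` and discriminant `δ`
admit a compatible indefinite quaternion structure, and does the PEL sub-family lie on every component?), in print for
`(ℚ(√-3), (3,3), [-2])` by `𝔔(D₆)` per the ring-2 account and Shimura's type-II families, NOT verified here for general
`(d, δ)`; (L) the LOCAL GERM at type-II members — the algebraicity locus of the flat Weil section contains a Euclidean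
neighbourhood of each type-II member — is OPEN: Bloch semiregularity is not available for the known representatives, and the
only printed truncation is the formal half (Bloch–Esnault–Kerz 2014 Thm. 1.2, typing item wi-69235). The file's content is
the EXACTNESS: granted (P), (L) is not merely sufficient but NECESSARY for the cell, so nothing is lost by attacking (L).

References: [MoonenZarhin1998WeilClasses] §1–2; [Murty1988] Thm. 2; [Shimura1963AnalyticFamilies] §4 (type II);
[vanGeemen1994HodgeAV] 4.8–4.14, Lemma 5.2, 5.3–5.5, 6.12; [Deligne1982HodgeCycles] §4, proof of Thm. 4.8, Rem. 4.10;
[CharlesSchnell2014Notes] Conj. 11.3.1, Prop. 11.3.11; [BuchweitzFlenner2003] Thm. 5.1–5.2; [BlochEsnaultKerz2014] Thm. 1.2;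
[Markman2025SecantWeil] Thm. 1.5.1 (preprint, unrefereed); [Markman2025SurveySecant] §11.5, §12.
-/

set_option linter.dupNamespace false

open CategoryTheory
open Literature.AlgebraicGeometry Literature.AlgebraicGeometry.Motives
open Literature.AlgebraicGeometry.HodgeTheory
open Literature.AlgebraicTopology.SingularHomology
open Literature.AlgebraicGeometry.VanGeemen1994
open Summit.HodgeConjecture.HodgeConjecture.Ring2.Hypotheses
open Summit.HodgeConjecture.HodgeConjecture.Ring2.AbelianAll
open Summit.HodgeConjecture.Ring2AbelianAll.NonsplitTypeIIWeilClasses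

namespace Summit.HodgeConjecture.HodgeConjecture.Theorems.SplitImpliesAllTypeIIAnchorGerm

/-! ## §1 The anti-compatible (type-II) anchor: definition, fact-free validity, refinement of the algebraic anchor -/

/-- **`antiCompatibleAnchor n d X x` — the TYPE-II ANCHOR.** The marked fibre `X` is charted by an abelian `2n`-fold `A₀`
with `φ₀ ≫ φ₀ = -(d • 𝟙 A₀)` such that the class `x` read on the chart lies in the Weil plane `weilClassesOf A₀ φ₀ n d`, and
`A₀` carries an ALGEBRAIC degree-two class `y` which is ANTI-COMPATIBLE (`φ₀^*y = -d·y`) with non-zero top power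
`y^{⌣2n} ≠ 0`. Met exactly on the Albert type-II loci `𝔔(D)` of the hyperbolic cells (`y = (𝟙+ψ)^*h − h − ψ^*h` for a
Rosati-symmetric invertible `ψ` anticommuting with `φ₀`); empty on the general member and at type-III points.
[cite: MoonenZarhin1998WeilClasses, §1–2 (second criterion)] [cite: vanGeemen1994HodgeAV, 4.8–4.11 and 6.12]
[cite: Shimura1963AnalyticFamilies, §4] -/
def antiCompatibleAnchor (n d : ℕ) (X : SchemeOver ℂ) (x : complexBetti X (2 * n)) : Prop :=
  ∃ (A₀ : AbelianVariety ℂ) (φ₀ : A₀ ⟶ A₀) (ι : A₀.X ≅ X), A₀.dim = 2 * n ∧ φ₀ ≫ φ₀ = -(d • 𝟙 A₀) ∧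
    complexBetti.map ι.hom (2 * n) x ∈ weilClassesOf A₀ φ₀ n d ∧
    ∃ y : complexBetti A₀.X 2, y ∈ algebraicClasses A₀.X 1 ∧
      complexBetti.map φ₀.hom.hom.hom 2 y = -((d : ℂ) • y) ∧ cupPowTwo y (2 * n) ≠ 0

/-- **The type-II anchor refines the algebraic anchor, FACT-FREE** (`n, d ≥ 1`): on the chart the whole Weil plane is
algebraic by the anti-compatible criterion (`weilClassesOf_le_algebraicClasses_of_anticompatible`), and algebraicity
transports back along the chart isomorphism. No rationality or Hodge-type hypothesis on `x` is needed.
[cite: MoonenZarhin1998WeilClasses, §2] [cite: GrothendieckTopology1969, §1] -/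
theorem algebraicAnchor_of_antiCompatibleAnchor {n d : ℕ} (hn : 0 < n) (hd : 0 < d) {X : SchemeOver ℂ}
    {x : complexBetti X (2 * n)} (h : antiCompatibleAnchor n d X x) : algebraicAnchor n X x := by
  obtain ⟨A₀, φ₀, ι, hA, hφ, hmem, y, hyalg, hy, htop⟩ := h
  exact (mem_algebraicClasses_map_iff_of_iso ι).1
    (weilClassesOf_le_algebraicClasses_of_anticompatible hn hd hA hφ hyalg hy htop hmem)

/-- **The type-II anchor is VALID in ring 2's sense, FACT-FREE**: a class anchored at a type-II chart is algebraic on the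
marked fibre (the shape consumed by `weilClassesComponent_of_pointed_of_local` / `…_of_variational`).
[cite: MoonenZarhin1998WeilClasses, §2] -/
theorem antiCompatibleAnchor_valid {n d : ℕ} (hn : 0 < n) (hd : 0 < d) :
    ∀ (X : SchemeOver ℂ) (x : complexBetti X (2 * n)), antiCompatibleAnchor n d X x → IsRationalClass x →
      IsOfHodgeType (2 * n) X (2 * n) n n x → x ∈ algebraicClasses X n :=
  fun _ _ h _ _ => algebraicAnchor_of_antiCompatibleAnchor hn hd h

/-- **A type-II member meets the anchor on its own fibre**: `(A, φ)` with an algebraic anti-compatible class of non-zero top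
power anchors every class of its Weil plane (chart = identity). [cite: vanGeemen1994HodgeAV, 6.12] -/
theorem antiCompatibleAnchor_self {A : AbelianVariety ℂ} {φ : A ⟶ A} {n d : ℕ} (hA : A.dim = 2 * n)
    (hφ : φ ≫ φ = -(d • 𝟙 A)) {y : complexBetti A.X 2} (hyalg : y ∈ algebraicClasses A.X 1)
    (hy : complexBetti.map φ.hom.hom.hom 2 y = -((d : ℂ) • y)) (htop : cupPowTwo y (2 * n) ≠ 0)
    {c : complexBetti A.X (2 * n)} (hc : c ∈ weilClassesOf A φ n d) : antiCompatibleAnchor n d A.X c := by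
  refine ⟨A, φ, Iso.refl _, hA, hφ, ?_, y, hyalg, hy, htop⟩
  have hid : complexBetti.map (Iso.refl A.X).hom (2 * n) c = c := by
    change complexBetti.map (𝟙 A.X) (2 * n) c = c
    rw [complexBetti.map_id]
    rfl
  rw [hid]
  exact hc

/-! ## §2 The engine at the type-II anchor, every cell `(ℚ(√-d), 2n, δ)`, `n, d ≥ 1`: sufficiency, necessity, exactness -/

/-- **Type-II pointedness + the local germ AT TYPE-II MEMBERS ⟹ the cell's Hodge statement** — ring 2's local anchor
engine at the fact-free type-II anchor. NO `HC_CM`, NO J1, NO Markman. [cite: CharlesSchnell2014Notes, Prop. 11.3.11 (proof)]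
[cite: BuchweitzFlenner2003, Thm. 5.1] [cite: MoonenZarhin1998WeilClasses, §2] -/
theorem weilClassesComponent_of_typeIIPointed_of_local {n d : ℕ} (hn : 0 < n) (hd : 0 < d) {δ : weilNormResidueGroup d}
    (hP : PointedWeilFamiliesComponent n d δ (antiCompatibleAnchor n d))
    (hL : LocalWeilVHCAtComponent n d δ (antiCompatibleAnchor n d)) : WeilClassesComponent n d δ :=
  weilClassesComponent_of_pointed_of_local (antiCompatibleAnchor_valid hn hd) hP hL

/-- **… ⟹ the cell's VARIATIONAL instance** (the K1 cell for `n = 3`), through ring 2's fact-free on-path lemma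
`weilVariationalHodgeComponent_of_weilClassesComponent`. [cite: CharlesSchnell2014Notes, Conj. 11.3.1 and Prop. 11.3.11] -/
theorem weilVariationalHodgeComponent_of_typeIIPointed_of_local {n d : ℕ} (hn : 0 < n) (hd : 0 < d)
    {δ : weilNormResidueGroup d} (hP : PointedWeilFamiliesComponent n d δ (antiCompatibleAnchor n d))
    (hL : LocalWeilVHCAtComponent n d δ (antiCompatibleAnchor n d)) : WeilVariationalHodgeComponent n d δ :=
  weilVariationalHodgeComponent_of_weilClassesComponent (weilClassesComponent_of_typeIIPointed_of_local hn hd hP hL)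

/-- **Type-II pointedness + the GLOBAL variational instance ⟹ the cell** (ring 2's global engine at the type-II anchor):
given type-II pointedness, the K1 cell gives the cell's Hodge statement WITHOUT Deligne's period construction J1.
[cite: CharlesSchnell2014Notes, Conj. 11.3.1] [cite: MoonenZarhin1998WeilClasses, §2] -/
theorem weilClassesComponent_of_typeIIPointed_of_variational {n d : ℕ} (hn : 0 < n) (hd : 0 < d)
    {δ : weilNormResidueGroup d} (hP : PointedWeilFamiliesComponent n d δ (antiCompatibleAnchor n d))
    (hV : WeilVariationalHodgeComponent n d δ) : WeilClassesComponent n d δ :=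
  weilClassesComponent_of_pointed_of_variational (antiCompatibleAnchor_valid hn hd) hP hV

/-- **NECESSITY: the local germ at type-II members is a CONSEQUENCE of the cell** (cell ⟹ variational instance ⟹ germ
at any anchor, `U = S(ℂ)`); fact-free. [cite: CharlesSchnell2014Notes, Conj. 11.3.1] -/
theorem localWeilVHCAtTypeII_of_weilClassesComponent {n d : ℕ} {δ : weilNormResidueGroup d}
    (h : WeilClassesComponent n d δ) : LocalWeilVHCAtComponent n d δ (antiCompatibleAnchor n d) :=
  localWeilVHCAtComponent_of_weilVariationalHodgeComponent (weilVariationalHodgeComponent_of_weilClassesComponent h) _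

/-- The germ at type-II members is WEAKER than the germ at all algebraic fibres (`LocalWeilVHCComponent`, which is
equivalent to the variational instance by `weilVariationalHodgeComponent_iff_local`): antitonicity along
`algebraicAnchor_of_antiCompatibleAnchor`. [folklore] -/
theorem localWeilVHCAtTypeII_of_localWeilVHCComponent {n d : ℕ} (hn : 0 < n) (hd : 0 < d)
    {δ : weilNormResidueGroup d} (hL : LocalWeilVHCComponent n d δ) :
    LocalWeilVHCAtComponent n d δ (antiCompatibleAnchor n d) :=
  LocalWeilVHCAtComponent.anti (fun _ _ h => algebraicAnchor_of_antiCompatibleAnchor hn hd h) hL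

/-- Type-II pointedness is STRONGER than R∞anc(δ) (`AnchoredWeilFamiliesComponent`, pointedness at the algebraic anchor).
[cite: Markman2025SecantWeil, §2.4 (preprint, unrefereed)] -/
theorem anchoredWeilFamiliesComponent_of_typeIIPointed {n d : ℕ} (hn : 0 < n) (hd : 0 < d)
    {δ : weilNormResidueGroup d} (hP : PointedWeilFamiliesComponent n d δ (antiCompatibleAnchor n d)) :
    AnchoredWeilFamiliesComponent n d δ :=
  PointedWeilFamiliesComponent.mono (fun _ _ h => algebraicAnchor_of_antiCompatibleAnchor hn hd h) hP

/-- **EXACTNESS per cell, granted type-II pointedness: the cell's Hodge statement ↔ the local germ at type-II members.**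
[cite: CharlesSchnell2014Notes, Conj. 11.3.1 and Prop. 11.3.11] [cite: MoonenZarhin1998WeilClasses, §2] -/
theorem weilClassesComponent_iff_localAtTypeII_of_typeIIPointed {n d : ℕ} (hn : 0 < n) (hd : 0 < d)
    {δ : weilNormResidueGroup d} (hP : PointedWeilFamiliesComponent n d δ (antiCompatibleAnchor n d)) :
    WeilClassesComponent n d δ ↔ LocalWeilVHCAtComponent n d δ (antiCompatibleAnchor n d) :=
  ⟨localWeilVHCAtTypeII_of_weilClassesComponent, weilClassesComponent_of_typeIIPointed_of_local hn hd hP⟩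

/-- **EXACTNESS per cell, granted type-II pointedness: the cell's VARIATIONAL instance (the K1 cell) ↔ the local germ at
type-II members** — Grothendieck's VHC on the δ-Weil families collapses to a GERM statement at ONE kind of member.
[cite: CharlesSchnell2014Notes, Conj. 11.3.1 and Prop. 11.3.11] -/
theorem weilVariationalHodgeComponent_iff_localAtTypeII_of_typeIIPointed {n d : ℕ} (hn : 0 < n) (hd : 0 < d)
    {δ : weilNormResidueGroup d} (hP : PointedWeilFamiliesComponent n d δ (antiCompatibleAnchor n d)) :
    WeilVariationalHodgeComponent n d δ ↔ LocalWeilVHCAtComponent n d δ (antiCompatibleAnchor n d) :=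
  ⟨fun hV => localWeilVHCAtComponent_of_weilVariationalHodgeComponent hV _,
    weilVariationalHodgeComponent_of_typeIIPointed_of_local hn hd hP⟩

/-! ## §3 Sixfolds: K1, the leaf `WeilSixfolds`, and the route's BC5 rung in germ currency -/

/-- **K1 ⟸ type-II pointedness ∧ type-II germ on every non-split right-sign sixfold cell**, fact-free.
[cite: CharlesSchnell2014Notes, Conj. 11.3.1 and Prop. 11.3.11] [cite: MoonenZarhin1998WeilClasses, §2] -/
theorem nonsplitSixfoldCells_of_typeIIPointed_of_local
    (h : ∀ d : ℕ, 0 < d → ∀ δ : weilNormResidueGroup d, δ ≠ splitDiscriminantClass 3 d → weilSign d δ = (-1) ^ 3 →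
      PointedWeilFamiliesComponent 3 d δ (antiCompatibleAnchor 3 d) ∧
        LocalWeilVHCAtComponent 3 d δ (antiCompatibleAnchor 3 d)) :
    Summit.HodgeConjecture.HodgeConjecture.Theses.SplitImpliesAll.NonsplitSixfoldCells :=
  fun d hd δ hδ hs =>
    weilVariationalHodgeComponent_of_typeIIPointed_of_local (by norm_num) hd (h d hd δ hδ hs).1 (h d hd δ hδ hs).2

/-- **K1 ⟹ the type-II germ on every non-split right-sign sixfold cell**, fact-free (necessity). [cite: CharlesSchnell2014Notes, Conj. 11.3.1] -/
theorem localAtTypeII_of_nonsplitSixfoldCells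
    (hK : Summit.HodgeConjecture.HodgeConjecture.Theses.SplitImpliesAll.NonsplitSixfoldCells) :
    ∀ d : ℕ, 0 < d → ∀ δ : weilNormResidueGroup d, δ ≠ splitDiscriminantClass 3 d → weilSign d δ = (-1) ^ 3 →
      LocalWeilVHCAtComponent 3 d δ (antiCompatibleAnchor 3 d) :=
  fun d hd δ hδ hs => localWeilVHCAtComponent_of_weilVariationalHodgeComponent (hK d hd δ hδ hs) _

/-- **Granted type-II pointedness of the non-split right-sign sixfold cells, K1 IS the type-II germ statement** — the
route's one open mathematical item equals ONE local statement at type-II members, cell by cell.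
[cite: CharlesSchnell2014Notes, Conj. 11.3.1 and Prop. 11.3.11] [cite: MoonenZarhin1998WeilClasses, §2] -/
theorem nonsplitSixfoldCells_iff_localAtTypeII_of_typeIIPointed
    (hP : ∀ d : ℕ, 0 < d → ∀ δ : weilNormResidueGroup d, δ ≠ splitDiscriminantClass 3 d → weilSign d δ = (-1) ^ 3 →
      PointedWeilFamiliesComponent 3 d δ (antiCompatibleAnchor 3 d)) :
    Summit.HodgeConjecture.HodgeConjecture.Theses.SplitImpliesAll.NonsplitSixfoldCells ↔
      ∀ d : ℕ, 0 < d → ∀ δ : weilNormResidueGroup d, δ ≠ splitDiscriminantClass 3 d → weilSign d δ = (-1) ^ 3 →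
        LocalWeilVHCAtComponent 3 d δ (antiCompatibleAnchor 3 d) :=
  ⟨localAtTypeII_of_nonsplitSixfoldCells, fun hL =>
    nonsplitSixfoldCells_of_typeIIPointed_of_local fun d hd δ hδ hs => ⟨hP d hd δ hδ hs, hL d hd δ hδ hs⟩⟩

/-- **The leaf `WeilSixfolds` ⟸ Markman's split theorem (HYPOTHESIS, preprint) ∧ type-II pointedness ∧ type-II germ on the
non-split right-sign cells** — NO `HC_CM`, NO J1: the split cells by name (`weilClassesComponent_split_three_of_markmanSixfolds'`,
Landherr's converse discharged in the tree), the non-split cells by §2, assembled through ring 2's fact-free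
`weilSixfolds_iff_negative_components`. [cite: Markman2025SecantWeil, Thm. 1.5.1 (preprint, unrefereed)]
[cite: vanGeemen1994HodgeAV, 4.14, Lemma 5.2 and (5.4.1)] [cite: MoonenZarhin1998WeilClasses, §2] -/
theorem weilSixfolds_of_markman2025_of_typeIIPointed_of_local (hM : Markman2025_weilClasses_algebraic_hyperbolicSixfold)
    (h : ∀ d : ℕ, 0 < d → ∀ δ : weilNormResidueGroup d, δ ≠ splitDiscriminantClass 3 d → weilSign d δ = (-1) ^ 3 →
      PointedWeilFamiliesComponent 3 d δ (antiCompatibleAnchor 3 d) ∧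
        LocalWeilVHCAtComponent 3 d δ (antiCompatibleAnchor 3 d)) :
    Summit.HodgeConjecture.HodgeConjecture.Theses.SevenfoldWeilCensus.WeilSixfolds :=
  weilSixfolds_iff_negative_components.2 fun d hd δ hs => by
    by_cases hδ : δ = splitDiscriminantClass 3 d
    · rw [hδ]
      exact weilClassesComponent_split_three_of_markmanSixfolds' hM hd
    · have hs' : weilSign d δ = (-1) ^ 3 := hs.trans (by decide : Odd 3).neg_one_pow.symm
      exact weilClassesComponent_of_typeIIPointed_of_local (by norm_num) hd (h d hd δ hδ hs').1 (h d hd δ hδ hs').2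

/-- **Granted Markman's split theorem and type-II pointedness, the leaf `WeilSixfolds` IS the type-II germ statement on
the non-split right-sign sixfold cells** (⟹: the leaf gives K1 fact-free, `SplitImpliesAllExactReach.nonsplitSixfoldCells_of_weilSixfolds`,
and K1 gives the germ; ⟸: the previous theorem). The seat brief's «single extra germ statement that extends it to all Weil
type of dimension 6», with a fact-free anchor. [cite: Markman2025SecantWeil, Thm. 1.5.1 (preprint, unrefereed)]
[cite: CharlesSchnell2014Notes, Conj. 11.3.1 and Prop. 11.3.11] [cite: MoonenZarhin1998WeilClasses, §2] -/
theorem weilSixfolds_iff_localAtTypeII_of_markman2025_of_typeIIPointed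
    (hM : Markman2025_weilClasses_algebraic_hyperbolicSixfold)
    (hP : ∀ d : ℕ, 0 < d → ∀ δ : weilNormResidueGroup d, δ ≠ splitDiscriminantClass 3 d → weilSign d δ = (-1) ^ 3 →
      PointedWeilFamiliesComponent 3 d δ (antiCompatibleAnchor 3 d)) :
    Summit.HodgeConjecture.HodgeConjecture.Theses.SevenfoldWeilCensus.WeilSixfolds ↔
      ∀ d : ℕ, 0 < d → ∀ δ : weilNormResidueGroup d, δ ≠ splitDiscriminantClass 3 d → weilSign d δ = (-1) ^ 3 →
        LocalWeilVHCAtComponent 3 d δ (antiCompatibleAnchor 3 d) :=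
  ⟨fun hW => localAtTypeII_of_nonsplitSixfoldCells
      (Summit.HodgeConjecture.HodgeConjecture.Theorems.SplitImpliesAllExactReach.nonsplitSixfoldCells_of_weilSixfolds hW),
    fun hL => weilSixfolds_of_markman2025_of_typeIIPointed_of_local hM fun d hd δ hδ hs => ⟨hP d hd δ hδ hs, hL d hd δ hδ hs⟩⟩

/-- **The route's plan-only BC5 rung in GERM CURRENCY.** The first non-split cell `(ℚ(√-3), 6, δ = [-2])` (the cell
containing the 6-dimensional type-II family `𝔔(D₆)`, `D₆ = (-3,2)_ℚ`): its variational instance — literally the statement of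
`Lines/birth.lean: stub_rung_firstCell` — follows from (P₆) type-II pointedness of that cell and (L₆) the local germ at its
type-II members. (P₆) is a moduli statement met in print by `𝔔(D₆)`; (L₆) is the OPEN germ statement (formal half in print:
Bloch–Esnault–Kerz Thm. 1.2). [cite: Shimura1963AnalyticFamilies, §4] [cite: BlochEsnaultKerz2014, Thm. 1.2]
[cite: CharlesSchnell2014Notes, Prop. 11.3.11] -/
theorem rung_firstCell_of_typeIIPointed_of_local
    (hP : PointedWeilFamiliesComponent 3 3
      (QuotientGroup.mk (Units.mk0 (-2 : ℚ) (by norm_num)) : weilNormResidueGroup 3) (antiCompatibleAnchor 3 3))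
    (hL : LocalWeilVHCAtComponent 3 3
      (QuotientGroup.mk (Units.mk0 (-2 : ℚ) (by norm_num)) : weilNormResidueGroup 3) (antiCompatibleAnchor 3 3)) :
    WeilVariationalHodgeComponent 3 3
      (QuotientGroup.mk (Units.mk0 (-2 : ℚ) (by norm_num)) : weilNormResidueGroup 3) :=
  weilVariationalHodgeComponent_of_typeIIPointed_of_local (by norm_num) (by norm_num) hP hL

end Summit.HodgeConjecture.HodgeConjecture.Theorems.SplitImpliesAllTypeIIAnchorGerm
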